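import Literature.MathematicalPhysics.QuantumLattice.HubbardSliceSymbolSmooth
import HarnessLib

/-!
# The shifted slice symbol as a smooth function of one momentum component: `|∂_p² p| ≲ βL²/Λ³`

Topic `MathematicalPhysics/QuantumLattice`; companion of `HubbardSliceSymbolSmooth.lean` (cell gate-hubbard-kl, R0-SCOPE-4 W2c).  There the
slice symbol `(w_Λ - w_{Λ′})·βL²/(-i(ω+θ)+ξ)` was differentiated twice in the frequency; here in one component `p` of the lattice
momentum, through the band `ξ(p) = -2cos p + e₀` (`e₀ = -2cos p′ - μ` collects the other component): first as a function of `ξ`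
(`sliceSymbolFnXi = W(ξ)·R(ξ)`, the weight `W` being the SAME symmetric function `sliceWeightFn Λ Λ′ ω ξ` of `HubbardSliceSymbolSmooth`
with the roles of `ω, ξ` exchanged, the resolvent `R(ξ) = c/(-i(ω+θ)+ξ)` now differentiated in `ξ`), then composed with the band
(`|ξ′| , |ξ″| ≤ 2`).  Result: the symbol is `C²` in `p` with **`‖∂_p² p‖ ≤ (128B₂ + 608B₁ + 544)·c/Λ³`** for `Λ ≤ 1`
(Benfatto–Giuliani–Mastropietro 2006, (2.36aa): momentum derivatives of a single-scale symbol cost inverse powers of the scale, the Fermi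
velocity being bounded).

* `resolventFnXi`, `…D1`, `…D2` and `sliceSymbolFnXi`, `…D1`, `…D2` with `hasDerivAt_…`, `norm_sliceSymbolFnXiD1_le`, `norm_sliceSymbolFnXiD2_le`;
* `bandFn e₀ p = -2cos p + e₀` and its derivatives;
* `momentumSymbolFn`, `…D1`, `…D2`: **`hasDerivAt_momentumSymbolFn`**, **`hasDerivAt_momentumSymbolFnD1`**, **`norm_momentumSymbolFnD2_le`**;
* `sliceSymbolFn_eq_sliceSymbolFnXi`, `cos_latticeMomentum_add_smul_single`, `nambuXi_add_smul_single`,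
  **`sliceSymbol_shift_eq_momentumSymbolFn`** — the lattice symbol translated by `m` momentum steps is the restriction of `Φ` at `p + m·2π/L`.

Everything is proved; the ten functions are the only definitions; no named facts.

## Sources

G. Benfatto, A. Giuliani, V. Mastropietro, Ann. Henri Poincaré 7 (2006) 809–898, (2.36aa), (2.50) (`BenfattoGiulianiMastropietro2006`);
M. Salmhofer, *Renormalization* (1999), §4.2.5 (4.70)–(4.71) (`Salmhofer1999`).
-/

noncomputable section

namespace Literature.MathematicalPhysics.QuantumLattice

open Literature.Probability.LatticeModels Set Complex

/-! ### The resolvent factor as a function of `ξ` -/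

/-- `R(ξ) = c/(-i(ω+θ)+ξ)` as a function of `ξ`. [cite: BenfattoGiulianiMastropietro2006, §2.1 (2.3)] -/
def resolventFnXi (c θ ω ξ : ℝ) : ℂ := (c : ℂ) / (-I * ((ω + θ : ℝ) : ℂ) + (ξ : ℂ))

/-- `∂_ξ R = -c/(-i(ω+θ)+ξ)²`. [cite: BenfattoGiulianiMastropietro2006, §2.1 (2.3)] -/
def resolventFnXiD1 (c θ ω ξ : ℝ) : ℂ := -(c : ℂ) / (-I * ((ω + θ : ℝ) : ℂ) + (ξ : ℂ)) ^ 2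

/-- `∂_ξ² R = 2c/(-i(ω+θ)+ξ)³`. [cite: BenfattoGiulianiMastropietro2006, §2.1 (2.3)] -/
def resolventFnXiD2 (c θ ω ξ : ℝ) : ℂ := 2 * (c : ℂ) / (-I * ((ω + θ : ℝ) : ℂ) + (ξ : ℂ)) ^ 3

/-- The denominator has `ξ`-derivative `1`. [cite: BenfattoGiulianiMastropietro2006, §2.1 (2.3)] -/
theorem hasDerivAt_shiftDen_xi (θ ω ξ : ℝ) : HasDerivAt (fun t : ℝ => -I * ((ω + θ : ℝ) : ℂ) + (t : ℂ)) 1 ξ := by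
  have h1 : HasDerivAt (fun t : ℝ => (t : ℂ)) 1 ξ := by simpa using (hasDerivAt_id ξ).ofReal_comp
  simpa using h1.const_add (-I * ((ω + θ : ℝ) : ℂ))

/-- `∂_ξ R = resolventFnXiD1` off the pole. [cite: BenfattoGiulianiMastropietro2006, §2.1 (2.3)] -/
theorem hasDerivAt_resolventFnXi {c θ ω ξ : ℝ} (h : (-I * ((ω + θ : ℝ) : ℂ) + (ξ : ℂ)) ≠ 0) :
    HasDerivAt (resolventFnXi c θ ω) (resolventFnXiD1 c θ ω ξ) ξ := by
  unfold resolventFnXi resolventFnXiD1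
  have hinv := ((hasDerivAt_inv h).comp ξ (hasDerivAt_shiftDen_xi θ ω ξ)).const_mul (c : ℂ)
  refine (hinv.congr_of_eventuallyEq (Filter.Eventually.of_forall fun t => ?_)).congr_deriv ?_
  · simp only [Function.comp, div_eq_mul_inv]
  · field_simp

/-- `∂_ξ² R = resolventFnXiD2` off the pole. [cite: BenfattoGiulianiMastropietro2006, §2.1 (2.3)] -/
theorem hasDerivAt_resolventFnXiD1 {c θ ω ξ : ℝ} (h : (-I * ((ω + θ : ℝ) : ℂ) + (ξ : ℂ)) ≠ 0) :
    HasDerivAt (resolventFnXiD1 c θ ω) (resolventFnXiD2 c θ ω ξ) ξ := by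
  unfold resolventFnXiD1 resolventFnXiD2
  have h2 : (-I * ((ω + θ : ℝ) : ℂ) + (ξ : ℂ)) ^ 2 ≠ 0 := pow_ne_zero 2 h
  have hsq : HasDerivAt (fun t : ℝ => (-I * ((ω + θ : ℝ) : ℂ) + (t : ℂ)) ^ 2)
      ((2 : ℕ) * (-I * ((ω + θ : ℝ) : ℂ) + (ξ : ℂ)) ^ (2 - 1) * 1) ξ :=
    (hasDerivAt_shiftDen_xi θ ω ξ).pow 2
  have hinv := ((hasDerivAt_inv h2).comp ξ hsq).const_mul (-(c : ℂ))
  refine (hinv.congr_of_eventuallyEq (Filter.Eventually.of_forall fun t => ?_)).congr_deriv ?_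
  · simp only [Function.comp, div_eq_mul_inv, neg_mul]
  · set a : ℂ := -I * ((ω + θ : ℝ) : ℂ) + (ξ : ℂ) with ha
    have h3 : a ^ 3 ≠ 0 := pow_ne_zero 3 h
    rw [show (2 : ℕ) - 1 = 1 from rfl, pow_one]
    field_simp
    ring

/-- `‖R‖ = c/|a|`. [cite: BenfattoGiulianiMastropietro2006, §2.1 (2.3)] -/
theorem norm_resolventFnXi {c : ℝ} (hc : 0 ≤ c) (θ ω ξ : ℝ) :
    ‖resolventFnXi c θ ω ξ‖ = c / ‖-I * ((ω + θ : ℝ) : ℂ) + (ξ : ℂ)‖ := by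
  rw [resolventFnXi, norm_div, Complex.norm_real, Real.norm_eq_abs, abs_of_nonneg hc]

/-- `‖∂_ξ R‖ = c/|a|²`. [cite: BenfattoGiulianiMastropietro2006, §2.1 (2.3)] -/
theorem norm_resolventFnXiD1 {c : ℝ} (hc : 0 ≤ c) (θ ω ξ : ℝ) :
    ‖resolventFnXiD1 c θ ω ξ‖ = c / ‖-I * ((ω + θ : ℝ) : ℂ) + (ξ : ℂ)‖ ^ 2 := by
  rw [resolventFnXiD1, norm_div, norm_neg, Complex.norm_real, Real.norm_eq_abs, abs_of_nonneg hc, norm_pow]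

/-- `‖∂_ξ² R‖ = 2c/|a|³`. [cite: BenfattoGiulianiMastropietro2006, §2.1 (2.3)] -/
theorem norm_resolventFnXiD2 {c : ℝ} (hc : 0 ≤ c) (θ ω ξ : ℝ) :
    ‖resolventFnXiD2 c θ ω ξ‖ = 2 * c / ‖-I * ((ω + θ : ℝ) : ℂ) + (ξ : ℂ)‖ ^ 3 := by
  rw [resolventFnXiD2, norm_div, norm_mul, Complex.norm_real, Real.norm_eq_abs, abs_of_nonneg hc, norm_pow]
  norm_num

/-! ### The slice symbol as a function of `ξ` -/

/-- `Ψ̂_ω(ξ) = W(ξ) R(ξ)`, the weight `W(ξ) = χ₂((ξ²+ω²)/Λ²) - χ₂((ξ²+ω²)/Λ′²) = sliceWeightFn Λ Λ′ ω ξ`. [cite: Salmhofer1999, §4.2.5 (4.70)] -/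
def sliceSymbolFnXi (c θ Λ Λ' ω ξ : ℝ) : ℂ := (sliceWeightFn Λ Λ' ω ξ : ℂ) * resolventFnXi c θ ω ξ

/-- `Ψ̂′ = W′R + WR′`. [cite: Salmhofer1999, §4.2.5 (4.70)] -/
def sliceSymbolFnXiD1 (c θ Λ Λ' ω ξ : ℝ) : ℂ :=
  (sliceWeightFnD1 Λ Λ' ω ξ : ℂ) * resolventFnXi c θ ω ξ + (sliceWeightFn Λ Λ' ω ξ : ℂ) * resolventFnXiD1 c θ ω ξ

/-- `Ψ̂″ = W″R + 2W′R′ + WR″`. [cite: Salmhofer1999, §4.2.5 (4.70)] -/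
def sliceSymbolFnXiD2 (c θ Λ Λ' ω ξ : ℝ) : ℂ :=
  (sliceWeightFnD2 Λ Λ' ω ξ : ℂ) * resolventFnXi c θ ω ξ + 2 * ((sliceWeightFnD1 Λ Λ' ω ξ : ℂ) * resolventFnXiD1 c θ ω ξ) +
    (sliceWeightFn Λ Λ' ω ξ : ℂ) * resolventFnXiD2 c θ ω ξ

section Xi

variable {c θ Λ Λ' ω : ℝ}

/-- Off the pole or identically zero: `ξ² + ω² > Λ²/5` forces a nonzero denominator (`|θ| ≤ Λ/4`).
[cite: BenfattoGiulianiMastropietro2006, (2.36aa)] -/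
theorem shiftDen_ne_zero_of_gt_xi (hθ : |θ| ≤ Λ / 4) {ξ : ℝ} (h : Λ ^ 2 / 5 < ξ ^ 2 + ω ^ 2) :
    (-I * ((ω + θ : ℝ) : ℂ) + (ξ : ℂ)) ≠ 0 :=
  shiftDen_ne_zero_of_gt hθ (by linarith)

/-- **`Ψ̂` is differentiable in `ξ` everywhere.** [cite: BenfattoGiulianiMastropietro2006, (2.36aa)] -/
theorem hasDerivAt_sliceSymbolFnXi (hΛ : 0 < Λ) (hΛΛ' : Λ ≤ Λ') (hθ : |θ| ≤ Λ / 4) (ξ : ℝ) :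
    HasDerivAt (sliceSymbolFnXi c θ Λ Λ' ω) (sliceSymbolFnXiD1 c θ Λ Λ' ω ξ) ξ := by
  by_cases h : Λ ^ 2 / 5 < ξ ^ 2 + ω ^ 2
  · unfold sliceSymbolFnXi sliceSymbolFnXiD1
    exact (hasDerivAt_sliceWeightFn Λ Λ' ω ξ).ofReal_comp.mul (hasDerivAt_resolventFnXi (shiftDen_ne_zero_of_gt_xi hθ h))
  · have hlt : ξ ^ 2 + ω ^ 2 < Λ ^ 2 / 4 := by linarith [not_lt.1 h, pow_pos hΛ 2]
    have hopen : ∀ᶠ t in nhds ξ, t ^ 2 + ω ^ 2 < Λ ^ 2 / 4 :=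
      (continuous_pow 2 |>.add continuous_const).continuousAt.eventually_lt continuousAt_const hlt
    have hev : sliceSymbolFnXi c θ Λ Λ' ω =ᶠ[nhds ξ] fun _ => (0 : ℂ) := by
      filter_upwards [hopen] with t ht
      rw [sliceSymbolFnXi, (sliceWeightFn_eq_zero_of_not_mem hΛ hΛΛ' (Or.inl ht)).1, Complex.ofReal_zero, zero_mul]
    have hD1 : sliceSymbolFnXiD1 c θ Λ Λ' ω ξ = 0 := by
      obtain ⟨h0, h1, -⟩ := sliceWeightFn_eq_zero_of_not_mem hΛ hΛΛ' (ξ := ω) (ω := ξ) (Or.inl hlt)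
      rw [sliceSymbolFnXiD1, h0, h1, Complex.ofReal_zero, zero_mul, zero_mul, add_zero]
    rw [hD1]
    exact (hasDerivAt_const ξ (0 : ℂ)).congr_of_eventuallyEq hev

/-- **`Ψ̂′` is differentiable in `ξ` everywhere.** [cite: BenfattoGiulianiMastropietro2006, (2.36aa)] -/
theorem hasDerivAt_sliceSymbolFnXiD1 (hΛ : 0 < Λ) (hΛΛ' : Λ ≤ Λ') (hθ : |θ| ≤ Λ / 4) (ξ : ℝ) :
    HasDerivAt (sliceSymbolFnXiD1 c θ Λ Λ' ω) (sliceSymbolFnXiD2 c θ Λ Λ' ω ξ) ξ := by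
  by_cases h : Λ ^ 2 / 5 < ξ ^ 2 + ω ^ 2
  · have hne := shiftDen_ne_zero_of_gt_xi hθ h
    unfold sliceSymbolFnXiD1 sliceSymbolFnXiD2
    have hA := (hasDerivAt_sliceWeightFnD1 Λ Λ' ω ξ).ofReal_comp.mul (hasDerivAt_resolventFnXi (c := c) hne)
    have hB := (hasDerivAt_sliceWeightFn Λ Λ' ω ξ).ofReal_comp.mul (hasDerivAt_resolventFnXiD1 (c := c) hne)
    refine (hA.add hB).congr_deriv ?_
    ring
  · have hlt : ξ ^ 2 + ω ^ 2 < Λ ^ 2 / 4 := by linarith [not_lt.1 h, pow_pos hΛ 2]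
    have hopen : ∀ᶠ t in nhds ξ, t ^ 2 + ω ^ 2 < Λ ^ 2 / 4 :=
      (continuous_pow 2 |>.add continuous_const).continuousAt.eventually_lt continuousAt_const hlt
    have hev : sliceSymbolFnXiD1 c θ Λ Λ' ω =ᶠ[nhds ξ] fun _ => (0 : ℂ) := by
      filter_upwards [hopen] with t ht
      obtain ⟨h0, h1, -⟩ := sliceWeightFn_eq_zero_of_not_mem hΛ hΛΛ' (ξ := ω) (ω := t) (Or.inl ht)
      rw [sliceSymbolFnXiD1, h0, h1, Complex.ofReal_zero, zero_mul, zero_mul, add_zero]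
    have hD2 : sliceSymbolFnXiD2 c θ Λ Λ' ω ξ = 0 := by
      obtain ⟨h0, h1, h2⟩ := sliceWeightFn_eq_zero_of_not_mem hΛ hΛΛ' (ξ := ω) (ω := ξ) (Or.inl hlt)
      rw [sliceSymbolFnXiD2, h0, h1, h2, Complex.ofReal_zero]
      ring
    rw [hD2]
    exact (hasDerivAt_const ξ (0 : ℂ)).congr_of_eventuallyEq hev

/-- **`‖Ψ̂′‖ ≤ (16B₁ + 16)·c/Λ²`** everywhere (`c ≥ 0`, `0 < Λ ≤ Λ′`, `|θ| ≤ Λ/4`). [cite: BenfattoGiulianiMastropietro2006, (2.36aa)] -/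
theorem norm_sliceSymbolFnXiD1_le (hΛ : 0 < Λ) (hΛΛ' : Λ ≤ Λ') (hθ : |θ| ≤ Λ / 4) (hc : 0 ≤ c) {B₁ : ℝ}
    (hB₁ : ∀ x, |deriv salmhoferCutoff x| ≤ B₁) (ξ : ℝ) :
    ‖sliceSymbolFnXiD1 c θ Λ Λ' ω ξ‖ ≤ (16 * B₁ + 16) * c / Λ ^ 2 := by
  have hB10 : 0 ≤ B₁ := (abs_nonneg _).trans (hB₁ 0)
  by_cases hmem : ξ ^ 2 + ω ^ 2 < Λ ^ 2 / 4 ∨ Λ' ^ 2 < ξ ^ 2 + ω ^ 2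
  · obtain ⟨h0, h1, -⟩ := sliceWeightFn_eq_zero_of_not_mem hΛ hΛΛ' hmem
    rw [sliceSymbolFnXiD1, h0, h1, Complex.ofReal_zero]
    simp only [zero_mul, add_zero, norm_zero]
    positivity
  · rw [not_or, not_lt, not_lt] at hmem
    have hden := norm_shiftDen_ge hθ (show Λ ^ 2 / 4 ≤ ω ^ 2 + ξ ^ 2 by linarith [hmem.1])
    set a := ‖-I * ((ω + θ : ℝ) : ℂ) + (ξ : ℂ)‖ with ha
    have ha0 : 0 < a := lt_of_lt_of_le (by positivity) hden
    have hR : ‖resolventFnXi c θ ω ξ‖ ≤ 4 * c / Λ := by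
      rw [norm_resolventFnXi hc, div_le_div_iff₀ ha0 hΛ]; nlinarith
    have hR1 : ‖resolventFnXiD1 c θ ω ξ‖ ≤ 16 * c / Λ ^ 2 := by
      rw [norm_resolventFnXiD1 hc, div_le_div_iff₀ (by positivity) (by positivity)]
      have : Λ ^ 2 ≤ 16 * a ^ 2 := by nlinarith
      nlinarith
    have hW : ‖(sliceWeightFn Λ Λ' ω ξ : ℂ)‖ ≤ 1 := by
      rw [Complex.norm_real, Real.norm_eq_abs]; exact abs_sliceWeightFn_le_one Λ Λ' ω ξ
    have hW1 : ‖(sliceWeightFnD1 Λ Λ' ω ξ : ℂ)‖ ≤ 4 * B₁ / Λ := by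
      rw [Complex.norm_real, Real.norm_eq_abs]; exact abs_sliceWeightFnD1_le hB₁ hΛ hΛΛ' ω ξ
    rw [sliceSymbolFnXiD1]
    calc _ ≤ ‖(sliceWeightFnD1 Λ Λ' ω ξ : ℂ) * resolventFnXi c θ ω ξ‖ + ‖(sliceWeightFn Λ Λ' ω ξ : ℂ) * resolventFnXiD1 c θ ω ξ‖ :=
          norm_add_le _ _
      _ ≤ 4 * B₁ / Λ * (4 * c / Λ) + 1 * (16 * c / Λ ^ 2) := by
          refine add_le_add ?_ ?_
          · rw [norm_mul]; exact mul_le_mul hW1 hR (norm_nonneg _) (by positivity)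
          · rw [norm_mul]; exact mul_le_mul hW hR1 (norm_nonneg _) zero_le_one
      _ = (16 * B₁ + 16) * c / Λ ^ 2 := by field_simp; ring

/-- **`‖Ψ̂″‖ ≤ (32B₂ + 144B₁ + 128)·c/Λ³`** everywhere. [cite: BenfattoGiulianiMastropietro2006, (2.36aa)] -/
theorem norm_sliceSymbolFnXiD2_le (hΛ : 0 < Λ) (hΛΛ' : Λ ≤ Λ') (hθ : |θ| ≤ Λ / 4) (hc : 0 ≤ c) {B₁ B₂ : ℝ}
    (hB₁ : ∀ x, |deriv salmhoferCutoff x| ≤ B₁) (hB₂ : ∀ x, |deriv (deriv salmhoferCutoff) x| ≤ B₂) (ξ : ℝ) :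
    ‖sliceSymbolFnXiD2 c θ Λ Λ' ω ξ‖ ≤ (32 * B₂ + 144 * B₁ + 128) * c / Λ ^ 3 := by
  have hB10 : 0 ≤ B₁ := (abs_nonneg _).trans (hB₁ 0)
  have hB20 : 0 ≤ B₂ := (abs_nonneg _).trans (hB₂ 0)
  by_cases hmem : ξ ^ 2 + ω ^ 2 < Λ ^ 2 / 4 ∨ Λ' ^ 2 < ξ ^ 2 + ω ^ 2
  · obtain ⟨h0, h1, h2⟩ := sliceWeightFn_eq_zero_of_not_mem hΛ hΛΛ' hmem
    rw [sliceSymbolFnXiD2, h0, h1, h2, Complex.ofReal_zero]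
    simp only [zero_mul, mul_zero, add_zero, norm_zero]
    positivity
  · rw [not_or, not_lt, not_lt] at hmem
    have hden := norm_shiftDen_ge hθ (show Λ ^ 2 / 4 ≤ ω ^ 2 + ξ ^ 2 by linarith [hmem.1])
    set a := ‖-I * ((ω + θ : ℝ) : ℂ) + (ξ : ℂ)‖ with ha
    have ha0 : 0 < a := lt_of_lt_of_le (by positivity) hden
    have hR : ‖resolventFnXi c θ ω ξ‖ ≤ 4 * c / Λ := by
      rw [norm_resolventFnXi hc, div_le_div_iff₀ ha0 hΛ]; nlinarith
    have hR1 : ‖resolventFnXiD1 c θ ω ξ‖ ≤ 16 * c / Λ ^ 2 := by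
      rw [norm_resolventFnXiD1 hc, div_le_div_iff₀ (by positivity) (by positivity)]
      have : Λ ^ 2 ≤ 16 * a ^ 2 := by nlinarith
      nlinarith
    have hR2 : ‖resolventFnXiD2 c θ ω ξ‖ ≤ 128 * c / Λ ^ 3 := by
      rw [norm_resolventFnXiD2 hc, div_le_div_iff₀ (by positivity) (by positivity)]
      have : Λ ^ 3 ≤ 64 * a ^ 3 := by nlinarith [pow_le_pow_left₀ (by positivity : 0 ≤ Λ / 4) hden 3]
      nlinarith
    have hW : ‖(sliceWeightFn Λ Λ' ω ξ : ℂ)‖ ≤ 1 := by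
      rw [Complex.norm_real, Real.norm_eq_abs]; exact abs_sliceWeightFn_le_one Λ Λ' ω ξ
    have hW1 : ‖(sliceWeightFnD1 Λ Λ' ω ξ : ℂ)‖ ≤ 4 * B₁ / Λ := by
      rw [Complex.norm_real, Real.norm_eq_abs]; exact abs_sliceWeightFnD1_le hB₁ hΛ hΛΛ' ω ξ
    have hW2 : ‖(sliceWeightFnD2 Λ Λ' ω ξ : ℂ)‖ ≤ (8 * B₂ + 4 * B₁) / Λ ^ 2 := by
      rw [Complex.norm_real, Real.norm_eq_abs]; exact abs_sliceWeightFnD2_le hB₁ hB₂ hΛ hΛΛ' ω ξ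
    rw [sliceSymbolFnXiD2]
    calc _ ≤ ‖(sliceWeightFnD2 Λ Λ' ω ξ : ℂ) * resolventFnXi c θ ω ξ‖ +
          ‖2 * ((sliceWeightFnD1 Λ Λ' ω ξ : ℂ) * resolventFnXiD1 c θ ω ξ)‖ +
          ‖(sliceWeightFn Λ Λ' ω ξ : ℂ) * resolventFnXiD2 c θ ω ξ‖ := norm_add₃_le
      _ ≤ (8 * B₂ + 4 * B₁) / Λ ^ 2 * (4 * c / Λ) + 2 * (4 * B₁ / Λ * (16 * c / Λ ^ 2)) + 1 * (128 * c / Λ ^ 3) := by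
          refine add_le_add (add_le_add ?_ ?_) ?_
          · rw [norm_mul]; exact mul_le_mul hW2 hR (norm_nonneg _) (by positivity)
          · rw [norm_mul, norm_mul, Complex.norm_ofNat]
            exact mul_le_mul_of_nonneg_left (mul_le_mul hW1 hR1 (norm_nonneg _) (by positivity)) (by norm_num)
          · rw [norm_mul]; exact mul_le_mul hW hR2 (norm_nonneg _) zero_le_one
      _ = (32 * B₂ + 144 * B₁ + 128) * c / Λ ^ 3 := by field_simp; ring

end Xi

/-! ### The band in one momentum component and the composed symbol -/

/-- The band as a function of one momentum component: `ξ(p) = -2cos p + e₀`. [cite: BenfattoGiulianiMastropietro2006, §2.1 (2.1)] -/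
def bandFn (e₀ p : ℝ) : ℝ := -2 * Real.cos p + e₀

/-- `ξ′(p) = 2 sin p`. [cite: BenfattoGiulianiMastropietro2006, §2.1 (2.1)] -/
theorem hasDerivAt_bandFn (e₀ p : ℝ) : HasDerivAt (bandFn e₀) (2 * Real.sin p) p := by
  unfold bandFn
  simpa using ((Real.hasDerivAt_cos p).const_mul (-2)).add_const e₀

/-- `(2 sin)′(p) = 2 cos p`. [cite: BenfattoGiulianiMastropietro2006, §2.1 (2.1)] -/
theorem hasDerivAt_two_sin (p : ℝ) : HasDerivAt (fun q : ℝ => 2 * Real.sin q) (2 * Real.cos p) p := by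
  simpa using (Real.hasDerivAt_sin p).const_mul 2

/-- The **slice symbol as a function of one momentum component**: `Φ(p) = Ψ̂_ω(ξ(p))`. [cite: Salmhofer1999, §4.2.5 (4.70)] -/
def momentumSymbolFn (c θ Λ Λ' ω e₀ p : ℝ) : ℂ := sliceSymbolFnXi c θ Λ Λ' ω (bandFn e₀ p)

/-- `Φ′(p) = Ψ̂′(ξ(p))·ξ′(p)`. [cite: Salmhofer1999, §4.2.5 (4.70)] -/
def momentumSymbolFnD1 (c θ Λ Λ' ω e₀ p : ℝ) : ℂ := ((2 * Real.sin p : ℝ) : ℂ) * sliceSymbolFnXiD1 c θ Λ Λ' ω (bandFn e₀ p)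

/-- `Φ″(p) = Ψ̂″(ξ(p)) ξ′(p)² + Ψ̂′(ξ(p)) ξ″(p)`. [cite: Salmhofer1999, §4.2.5 (4.70)] -/
def momentumSymbolFnD2 (c θ Λ Λ' ω e₀ p : ℝ) : ℂ :=
  ((2 * Real.sin p : ℝ) : ℂ) * (((2 * Real.sin p : ℝ) : ℂ) * sliceSymbolFnXiD2 c θ Λ Λ' ω (bandFn e₀ p)) +
    ((2 * Real.cos p : ℝ) : ℂ) * sliceSymbolFnXiD1 c θ Λ Λ' ω (bandFn e₀ p)

section Momentum

variable {c θ Λ Λ' ω e₀ : ℝ}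

/-- **`Φ` is differentiable with derivative `Φ′`.** [cite: BenfattoGiulianiMastropietro2006, (2.36aa)] -/
theorem hasDerivAt_momentumSymbolFn (hΛ : 0 < Λ) (hΛΛ' : Λ ≤ Λ') (hθ : |θ| ≤ Λ / 4) (p : ℝ) :
    HasDerivAt (momentumSymbolFn c θ Λ Λ' ω e₀) (momentumSymbolFnD1 c θ Λ Λ' ω e₀ p) p := by
  unfold momentumSymbolFn momentumSymbolFnD1
  have h := (hasDerivAt_sliceSymbolFnXi (c := c) (ω := ω) hΛ hΛΛ' hθ (bandFn e₀ p)).scomp p (hasDerivAt_bandFn e₀ p)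
  refine h.congr_deriv ?_
  rw [Complex.real_smul]

/-- **`Φ′` is differentiable with derivative `Φ″`.** [cite: BenfattoGiulianiMastropietro2006, (2.36aa)] -/
theorem hasDerivAt_momentumSymbolFnD1 (hΛ : 0 < Λ) (hΛΛ' : Λ ≤ Λ') (hθ : |θ| ≤ Λ / 4) (p : ℝ) :
    HasDerivAt (momentumSymbolFnD1 c θ Λ Λ' ω e₀) (momentumSymbolFnD2 c θ Λ Λ' ω e₀ p) p := by
  unfold momentumSymbolFnD1 momentumSymbolFnD2
  have h1 := (hasDerivAt_sliceSymbolFnXiD1 (c := c) (ω := ω) hΛ hΛΛ' hθ (bandFn e₀ p)).scomp p (hasDerivAt_bandFn e₀ p)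
  have h2 := (hasDerivAt_two_sin p).ofReal_comp
  refine (h2.mul h1).congr_deriv ?_
  rw [Complex.real_smul]
  simp only [Function.comp_apply]
  push_cast
  ring

/-- **The second momentum derivative of the slice symbol is at most `(128B₂ + 608B₁ + 544)·c/Λ³`** for `0 < Λ ≤ Λ′`, `Λ ≤ 1`,
`|θ| ≤ Λ/4`, `c ≥ 0`. [cite: BenfattoGiulianiMastropietro2006, (2.36aa)] -/
theorem norm_momentumSymbolFnD2_le (hΛ : 0 < Λ) (hΛΛ' : Λ ≤ Λ') (hΛ1 : Λ ≤ 1) (hθ : |θ| ≤ Λ / 4) (hc : 0 ≤ c) {B₁ B₂ : ℝ}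
    (hB₁ : ∀ x, |deriv salmhoferCutoff x| ≤ B₁) (hB₂ : ∀ x, |deriv (deriv salmhoferCutoff) x| ≤ B₂) (p : ℝ) :
    ‖momentumSymbolFnD2 c θ Λ Λ' ω e₀ p‖ ≤ (128 * B₂ + 608 * B₁ + 544) * c / Λ ^ 3 := by
  have hB10 : 0 ≤ B₁ := (abs_nonneg _).trans (hB₁ 0)
  have hB20 : 0 ≤ B₂ := (abs_nonneg _).trans (hB₂ 0)
  have hs : ‖((2 * Real.sin p : ℝ) : ℂ)‖ ≤ 2 := by
    rw [Complex.norm_real, Real.norm_eq_abs, abs_mul, abs_of_pos (by norm_num : (0:ℝ) < 2)]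
    linarith [Real.abs_sin_le_one p]
  have hco : ‖((2 * Real.cos p : ℝ) : ℂ)‖ ≤ 2 := by
    rw [Complex.norm_real, Real.norm_eq_abs, abs_mul, abs_of_pos (by norm_num : (0:ℝ) < 2)]
    linarith [Real.abs_cos_le_one p]
  have h2 := norm_sliceSymbolFnXiD2_le (c := c) (ω := ω) hΛ hΛΛ' hθ hc hB₁ hB₂ (bandFn e₀ p)
  have h1 := norm_sliceSymbolFnXiD1_le (c := c) (ω := ω) hΛ hΛΛ' hθ hc hB₁ (bandFn e₀ p)
  have h1' : ‖sliceSymbolFnXiD1 c θ Λ Λ' ω (bandFn e₀ p)‖ ≤ (16 * B₁ + 16) * c / Λ ^ 3 := by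
    refine h1.trans ?_
    rw [div_le_div_iff₀ (by positivity) (by positivity)]
    have : Λ ^ 3 ≤ Λ ^ 2 := by nlinarith [pow_pos hΛ 2]
    nlinarith [mul_le_mul_of_nonneg_left this (by positivity : 0 ≤ (16 * B₁ + 16) * c)]
  rw [momentumSymbolFnD2]
  calc _ ≤ ‖((2 * Real.sin p : ℝ) : ℂ) * (((2 * Real.sin p : ℝ) : ℂ) * sliceSymbolFnXiD2 c θ Λ Λ' ω (bandFn e₀ p))‖ +
        ‖((2 * Real.cos p : ℝ) : ℂ) * sliceSymbolFnXiD1 c θ Λ Λ' ω (bandFn e₀ p)‖ := norm_add_le _ _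
    _ ≤ 2 * (2 * ((32 * B₂ + 144 * B₁ + 128) * c / Λ ^ 3)) + 2 * ((16 * B₁ + 16) * c / Λ ^ 3) := by
        refine add_le_add ?_ ?_
        · rw [norm_mul, norm_mul]
          exact mul_le_mul hs (mul_le_mul hs h2 (norm_nonneg _) (by norm_num)) (by positivity) (by norm_num)
        · rw [norm_mul]
          exact mul_le_mul hco h1' (norm_nonneg _) (by norm_num)
    _ = (128 * B₂ + 608 * B₁ + 544) * c / Λ ^ 3 := by ring

end Momentum

/-! ### The lattice symbol and its momentum translates are the restriction -/

/-- `Ψ_ξ(ω) = Ψ̂_ω(ξ)`: the two parametrisations of the continuum symbol agree. [cite: Salmhofer1999, §4.2.5 (4.70)] -/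
theorem sliceSymbolFn_eq_sliceSymbolFnXi (c θ Λ Λ' ξ ω : ℝ) :
    sliceSymbolFn c θ Λ Λ' ξ ω = sliceSymbolFnXi c θ Λ Λ' ω ξ := by
  simp only [sliceSymbolFn, sliceSymbolFnXi, sliceWeightFn, resolventFn, resolventFnXi, add_comm (ω ^ 2) (ξ ^ 2)]

/-- `m • e_i = Pi.single i m` in `(ℤ/L)²`. [cite: BenfattoGiulianiMastropietro2006, §2.1 (2.1)] -/
theorem nsmul_single_one {L : ℕ} (i : Fin 2) (m : ℕ) :
    m • (Pi.single i (1 : ZMod L) : TorusSite 2 L) = (Pi.single i (m : ZMod L) : TorusSite 2 L) := by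
  ext l
  rcases eq_or_ne l i with rfl | h
  · simp
  · simp [Pi.single_eq_of_ne h]

/-- **The cosine of a translated lattice momentum**: `cos(p_{k⃗ + m e_i, i}) = cos(p_{k⃗,i} + m·2π/L)` (only the residue matters).
[cite: BenfattoGiulianiMastropietro2006, §2.1 (2.1)] -/
theorem cos_latticeMomentum_add_smul_single {L : ℕ} [NeZero L] (k : TorusSite 2 L) (i : Fin 2) (m : ℕ) :
    Real.cos (latticeMomentum L (k + m • (Pi.single i (1 : ZMod L) : TorusSite 2 L)) i) =
      Real.cos (latticeMomentum L k i + m * (2 * Real.pi / L)) := by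
  have hL : (0 : ℝ) < L := by exact_mod_cast Nat.pos_of_ne_zero (NeZero.ne L)
  have key : ∀ n : ℕ, Real.cos (2 * Real.pi * ((n % L : ℕ) : ℝ) / L) = Real.cos (2 * Real.pi * (n : ℝ) / L) := by
    intro n
    conv_rhs => rw [← Nat.mod_add_div n L]
    push_cast
    rw [show 2 * Real.pi * (((n % L : ℕ) : ℝ) + (L : ℝ) * ((n / L : ℕ) : ℝ)) / L =
        2 * Real.pi * ((n % L : ℕ) : ℝ) / L + ((n / L : ℕ) : ℝ) * (2 * Real.pi) by field_simp,
      Real.cos_add_nat_mul_two_pi]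
  rw [nsmul_single_one]
  simp only [latticeMomentum, Pi.add_apply, Pi.single_eq_same]
  rw [ZMod.val_add, ZMod.val_natCast, Nat.add_mod_mod, key]
  congr 1
  push_cast
  field_simp

/-- The other component is unchanged: `(k⃗ + m e_i)_l = k⃗_l` for `l ≠ i`. [cite: BenfattoGiulianiMastropietro2006, §2.1 (2.1)] -/
theorem apply_add_smul_single_of_ne {L : ℕ} (k : TorusSite 2 L) {i l : Fin 2} (h : l ≠ i) (m : ℕ) :
    (k + m • (Pi.single i (1 : ZMod L) : TorusSite 2 L)) l = k l := by
  rw [nsmul_single_one, Pi.add_apply, Pi.single_eq_of_ne h, add_zero]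

/-- **The band at a translated momentum**: `ξ(k⃗ + m e_i) = bandFn e₀ (p_i + m·2π/L)` with `e₀ = ξ(k⃗) + 2cos p_i` (the other
component rides in `e₀`). [cite: BenfattoGiulianiMastropietro2006, §2.1 (2.1)] -/
theorem nambuXi_add_smul_single {L : ℕ} [NeZero L] (μ : ℝ) (k : TorusSite 2 L) (i : Fin 2) (m : ℕ) :
    nambuXi L μ (k + m • (Pi.single i (1 : ZMod L) : TorusSite 2 L)) =
      bandFn (nambuXi L μ k + 2 * Real.cos (latticeMomentum L k i)) (latticeMomentum L k i + m * (2 * Real.pi / L)) := by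
  have split : ∀ g : Fin 2 → ℝ, ∑ l, g l = g i + ∑ l ∈ Finset.univ.erase i, g l :=
    fun g => (Finset.add_sum_erase Finset.univ g (Finset.mem_univ i)).symm
  have hrest : ∑ l ∈ Finset.univ.erase i, Real.cos (latticeMomentum L (k + m • (Pi.single i (1 : ZMod L) : TorusSite 2 L)) l) =
      ∑ l ∈ Finset.univ.erase i, Real.cos (latticeMomentum L k l) := by
    refine Finset.sum_congr rfl fun l hl => ?_
    rw [latticeMomentum, latticeMomentum, apply_add_smul_single_of_ne k (Finset.ne_of_mem_erase hl) m]
  simp only [nambuXi, torusBand, bandFn]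
  rw [split (fun l => Real.cos (latticeMomentum L (k + m • (Pi.single i (1 : ZMod L) : TorusSite 2 L)) l)),
    split (fun l => Real.cos (latticeMomentum L k l)), hrest, cos_latticeMomentum_add_smul_single]
  ring

/-- **The shifted slice symbol along a momentum line is the restriction of `Φ`**: for `0 < β`, `|βθ| ≤ π/4`, every Matsubara index
`n`, momentum `k⃗`, direction `i` and step count `m`,
`(w_Λ - w_{Λ′})·p_θ((n, k⃗ + m e_i), σ) = Φ(p_{k⃗,i} + m·2π/L)` with `c = βL²`, `ω = ω_n`, `e₀ = ξ(k⃗) + 2cos p_{k⃗,i}`.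
[cite: Salmhofer1999, §4.2.5 (4.70)] -/
theorem sliceSymbol_shift_eq_momentumSymbolFn {L M : ℕ} [NeZero L] {β : ℝ} (hβ : 0 < β) (μ : ℝ) {θ : ℝ}
    (hθ : |β * θ| ≤ Real.pi / 4) (Λ Λ' : ℝ) (n : MatsubaraIdx M) (k : TorusSite 2 L) (i : Fin 2) (m : ℕ) (σ : Fin 2) :
    ((hubbardCutoffWeight L M β μ Λ (n, k + m • (Pi.single i (1 : ZMod L) : TorusSite 2 L)) : ℂ) -
        (hubbardCutoffWeight L M β μ Λ' (n, k + m • (Pi.single i (1 : ZMod L) : TorusSite 2 L)) : ℂ)) *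
        shiftedFreeSymbol L M β μ θ ((n, k + m • (Pi.single i (1 : ZMod L) : TorusSite 2 L)), σ) =
      momentumSymbolFn (β * (L : ℝ) ^ 2) θ Λ Λ' (matsubaraFreq β M n) (nambuXi L μ k + 2 * Real.cos (latticeMomentum L k i))
        (latticeMomentum L k i + m * (2 * Real.pi / L)) := by
  rw [sliceSymbol_eq_sliceSymbolFn hβ μ hθ, sliceSymbolFn_eq_sliceSymbolFnXi, momentumSymbolFn, nambuXi_add_smul_single]

end Literature.MathematicalPhysics.QuantumLattice

end
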